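import Mathlib
import HarnessLib

/-!
# Route `KLProgramme` — crux K3 ENGINE (gen 8 engine-flow child stmt-HubbardSuperconductivity-20437 `KLRegimeEngineV17F2`), stub (b)
# `stub_engine_step_norms`: the DIMENSIONLESS BLOCKED-TOWER BOOKKEEPING, part 1 — majorant functionals and geometric profiles
# (E1 lead r2d-p2 g5, memo E1-TOWER-BLOCKED §7, evidence #4 on 20437)

Cell gate-hubbard-kl.  The (E1) law `CE^p ε_j^{p−1} 2^{(3p−5)j}` of the irrelevant kernels (`2p ≥ 6` legs) along the internal tower of stub (b) at the
fixed frame `K_n` is a statement about a BLOCKED, GRADED, BIRTH-LEVEL recursion: the increments `Δ^{[k]} = 𝒱_{J_k} − 𝒱_{J_{k−1}}` born at the block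
boundaries `J_k = k·d` (born sizes `b k p`, in units of `2^{(3p−5)J_k}`), re-measured at later boundaries with the relative sector count (gain
`g^{(m−2)·(jump in blocks)}`, `g = 2^{−d}`, per-leg-pair constant `c₂`, prefactor `c₁`: measured sizes `μ k m`, the inputs of the block step `k → k+1`),
and the block step = exact binomial–Gram first order (`C(2m,2p) σ^{m−p}`, k3c2-p3's `sum_norm_kernel_gaussConv_sub_le_binomial_of_gramBounded`) +
the GRADED orders `n ≥ 2` in product form with the leg constraint `Σ_a δ_a ≥ p + n − 1` (`e Φ^{n−1} ψ^p S_n(p)`, supplier G1 of the memo) + a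
geometric tail.  This file: the three majorant functionals and what they do to GEOMETRIC profiles `μ m ≤ A' λ^{m−1} Q'^m`:

* `towerFO`, `towerV`, `towerS` — first order; the field-weighted norm `‖V‖_h` at output radius `κ` (`(e²·2κ)^{2m} = (eτ)^m`); the constrained
  graded product sum;
* **`towerMeasured_le_profile`** (T1) — a born profile `b k' m ≤ A λ^{m−1} Q^m` (`k' ≤ k`) re-measured with `Σ_{k'≤k} c₁ c₂^m g^{(m−2)(k+1−k')}`
  is again geometric, `μ k m ≤ (c₁A/((1−g)g²)) · λ^{m−1} · (c₂ g Q)^m` (the jump of ≥ 1 block pays `g^{m−2}`, older increments a geometric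
  series); `towerMeasured_le_profile₀` (T1′) — the jump-`≥ 0` read-out variant, `≤ (c₁A/(1−g)) · λ^{m−1} · (c₂ Q)^m`;
* `towerFO_le` — `FO(p) ≤ A' λ^{p−1} (4Q')^p · x₁/(1−x₁)`, `x₁ = 4σλQ'` (`C(2m,2p) ≤ 4^m`);  `towerV_le` — `V ≤ A'·eτQ'/(1 − eτλQ')`;
* **`towerS_le`** — the graded sum keeps the perturbative order: `S_n(p) ≤ A'^n λ^{p−1} (2τQ')^{p+n−1}` (`2λτQ' ≤ 1`): the constraint trades the
  excess legs for `2^{−Σδ}` and the free product sum `(Σ_j 2^{−j})^n ≤ 1` does the counting, uniformly in `D` — the real-number reason the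
  graded form carries `ε^{p−1}` while the flat `‖V‖_hⁿ` does not (r2d-p2 g4 E1-FIT-PLAN §4).

Part 2 (`…EngineTowerBookkeeping`): the closed-form block step (T2) and the induction over blocks (T3).
Dictionary (dimensional → dimensionless, boundary `J = J_{k+1}`, sizes in degree `2m` divided by `2^{(3m−5)J}`): `σ = κ_Γ²·8^J` (Gram constant of the
block covariance per contracted pair), `ψ = κ_Γ^{−2}·8^{−J}`, `τ = 4e³κ_Γ²·8^J`, `Φ = e·α_Γ·32^{−J}/κ_Γ²` (so `θ = eα‖V‖_h/κ² = Φ·towerV`, the tail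
`κ^{−2p} e‖V‖_h θ^N/(1−θ)` becomes `ψ^p e V (ΦV)^N/(1−ΦV)`, and the graded term `(eα/κ²)^{n−1} κ^{−2p} Π(4e³κ²)^{δ_a} N(δ_a)` of `cumulantBound`
becomes `Φ^{n−1} ψ^p Π τ^{δ_a} μ(δ_a)` exactly); `g = 2^{−d}`, `c₂` = (per-leg re-measurement constant)², `λ = B·ε`.  All four step constants are
`k`-INDEPENDENT (`κ_j² ∝ 8^{−j}`, `α_j ∝ 4^j`: p515376).  Pure real analysis; nothing about the model is asserted.
References: Benfatto–Giuliani–Mastropietro 2006 §2.8 (2.83), (2.93)–(2.98) (dimensional bounds, short memory); Gawȩdzki–Kupiainen 1985 §3.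
-/
noncomputable section

namespace Summit.HubbardSuperconductivity.HubbardSuperconductivity.Theorems.EngineV8

set_option linter.dupNamespace false -- summit = problem name (single-conjunct summit), D-0017

open Real Finset

/-! ## §0 The majorant functionals of the block step -/

/-- **First order of the block step** (binomial–Gram, identity excluded): `FO(p) = Σ_{m ∈ (p, D]} C(2m, 2p) · σ^{m−p} · μ(m)` — the degree-`2p`
part of `e^{Δ_Γ}𝒱 − 𝒱` from the degree-`2m` kernels of `𝒱` with `m − p` self-contracted pairs (Gram constant `σ` per pair, dimensionless). -/
def towerFO (D : ℕ) (σ : ℝ) (μ : ℕ → ℝ) (p : ℕ) : ℝ :=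
  ∑ m ∈ Ioc p D, ((2 * m).choose (2 * p) : ℝ) * σ ^ (m - p) * μ m

/-- **The field-weighted norm of the inputs at output radius `κ`**: `V = Σ_{m ∈ [1, D]} (eτ)^m μ(m)` (`‖𝒱‖_h` with `(e²(κ+κ))^{2m} = (e·4e³κ²)^m`,
`τ = 4e³κ²` dimensionless); the cumulant series converges for `Φ·V < 1`. -/
def towerV (D : ℕ) (τ : ℝ) (μ : ℕ → ℝ) : ℝ :=
  ∑ m ∈ Icc 1 D, (exp 1 * τ) ^ m * μ m

/-- **The graded product sum of order `n` in output degree `2p`**: `S_n(p) = Σ_{δ ∈ [1,D]^n, p+n−1 ≤ Σ_a δ_a} Π_a τ^{δ_a} μ(δ_a)` — the `n`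
input kernels of half-degrees `δ_a` joined by `n − 1` lines leave at most `2Σδ_a − 2(n−1)` legs, so degree `2p` needs `Σδ_a ≥ p + n − 1`
(the constraint that carries the perturbative order `λ^{p−1}`). -/
def towerS (D : ℕ) (τ : ℝ) (μ : ℕ → ℝ) (n p : ℕ) : ℝ :=
  ∑ δ ∈ (Fintype.piFinset fun _ : Fin n => Icc 1 D) with p + n - 1 ≤ ∑ a, δ a, ∏ a, τ ^ (δ a) * μ (δ a)

/-- `FO ≥ 0` for nonnegative data. -/
theorem towerFO_nonneg {D : ℕ} {σ : ℝ} {μ : ℕ → ℝ} (hσ : 0 ≤ σ) (hμ : ∀ m, 0 ≤ μ m) (p : ℕ) : 0 ≤ towerFO D σ μ p :=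
  sum_nonneg fun m _ => by have := hμ m; positivity

/-- `V ≥ 0` for nonnegative data. -/
theorem towerV_nonneg {D : ℕ} {τ : ℝ} {μ : ℕ → ℝ} (hτ : 0 ≤ τ) (hμ : ∀ m, 0 ≤ μ m) : 0 ≤ towerV D τ μ :=
  sum_nonneg fun m _ => by have := hμ m; positivity

/-- `S_n(p) ≥ 0` for nonnegative data. -/
theorem towerS_nonneg {D : ℕ} {τ : ℝ} {μ : ℕ → ℝ} (hτ : 0 ≤ τ) (hμ : ∀ m, 0 ≤ μ m) (n p : ℕ) : 0 ≤ towerS D τ μ n p :=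
  sum_nonneg fun δ _ => prod_nonneg fun a _ => by have := hμ (δ a); positivity

/-! ## §1 (T1) Re-measurement of a born geometric profile -/

/-- A finite geometric sum from exponent `1`: `Σ_{t < n} g^{t+1} ≤ g/(1−g)` for `0 ≤ g < 1`. -/
theorem sum_range_pow_succ_le {g : ℝ} (hg0 : 0 ≤ g) (hg1 : g < 1) (n : ℕ) :
    ∑ t ∈ range n, g ^ (t + 1) ≤ g / (1 - g) := by
  have h := geom_sum_Ico_le_of_lt_one hg0 hg1 (m := 1) (n := n + 1)
  rw [pow_one] at h
  refine le_trans (le_of_eq ?_) h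
  rw [sum_Ico_eq_sum_range]
  simp only [Nat.add_sub_cancel, add_comm 1]

/-- **(T1) The measured sizes of a born geometric profile are geometric**: if every increment born at a boundary `k' ≤ k` obeys
`b k' m ≤ A λ^{m−1} Q^m` (`3 ≤ m ≤ D`) and the inputs of the step `k → k+1` are bounded by the blocked re-measurement sum
`μ k m ≤ Σ_{k' ≤ k} c₁ c₂^m g^{(m−2)(k+1−k')} b k' m` (relative sector count: per-leg-pair constant `c₂`, gain `g = 2^{−d}` per excess leg pair and
block of jump), then `μ k m ≤ (c₁ A/((1−g) g²)) · λ^{m−1} · (c₂ g Q)^m` — the jump of at least one block pays `g^{m−2}`, the older increments a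
geometric series. -/
theorem towerMeasured_le_profile {D : ℕ} {b μ : ℕ → ℕ → ℝ} {A lam Q g c₁ c₂ : ℝ}
    (hA : 0 ≤ A) (hlam : 0 ≤ lam) (hQ : 0 ≤ Q) (hg0 : 0 < g) (hg1 : g < 1) (hc₁ : 0 ≤ c₁) (hc₂ : 0 ≤ c₂)
    (hb0 : ∀ k m, 0 ≤ b k m) {k : ℕ}
    (hμ : ∀ m, 3 ≤ m → m ≤ D → μ k m ≤ ∑ k' ∈ range (k + 1), c₁ * c₂ ^ m * g ^ ((m - 2) * (k + 1 - k')) * b k' m)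
    (hborn : ∀ k' ≤ k, ∀ m, 3 ≤ m → m ≤ D → b k' m ≤ A * lam ^ (m - 1) * Q ^ m)
    {m : ℕ} (hm : 3 ≤ m) (hmD : m ≤ D) :
    μ k m ≤ c₁ * A / ((1 - g) * g ^ 2) * lam ^ (m - 1) * (c₂ * g * Q) ^ m := by
  have hg1' : 0 < 1 - g := sub_pos.2 hg1
  refine (hμ m hm hmD).trans ?_
  -- each term: the born law, and `g^{(m-2)(k+1-k')} ≤ g^{m-3} · g^{k+1-k'}`
  have hterm : ∀ k' ∈ range (k + 1), c₁ * c₂ ^ m * g ^ ((m - 2) * (k + 1 - k')) * b k' m ≤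
      (c₁ * c₂ ^ m * g ^ (m - 3) * (A * lam ^ (m - 1) * Q ^ m)) * g ^ (k - k' + 1) := by
    intro k' hk'
    have hk'le : k' ≤ k := Nat.lt_succ_iff.1 (mem_range.1 hk')
    have hpow : g ^ ((m - 2) * (k + 1 - k')) ≤ g ^ (m - 3) * g ^ (k - k' + 1) := by
      rw [← pow_add]
      refine pow_le_pow_of_le_one hg0.le hg1.le ?_
      have h1 : k + 1 - k' = k - k' + 1 := by omega
      rw [h1]
      have : m - 2 = (m - 3) + 1 := by omega
      rw [this]
      nlinarith [Nat.zero_le (m - 3), Nat.zero_le (k - k')]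
    calc c₁ * c₂ ^ m * g ^ ((m - 2) * (k + 1 - k')) * b k' m
        ≤ c₁ * c₂ ^ m * (g ^ (m - 3) * g ^ (k - k' + 1)) * (A * lam ^ (m - 1) * Q ^ m) := by
          have := hborn k' hk'le m hm hmD
          have := hb0 k' m
          gcongr
      _ = _ := by ring
  refine (sum_le_sum hterm).trans ?_
  rw [← mul_sum]
  have hgeom : ∑ k' ∈ range (k + 1), g ^ (k - k' + 1) ≤ g / (1 - g) := by
    have hrefl := sum_range_reflect (fun t => g ^ (t + 1)) (k + 1)
    -- `Σ_{k'} g^{k - k' + 1} = Σ_t g^{t+1}`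
    have : ∑ k' ∈ range (k + 1), g ^ (k - k' + 1) = ∑ t ∈ range (k + 1), g ^ (t + 1) := by
      rw [← hrefl]
      refine sum_congr rfl fun j hj => ?_
      simp only [Nat.add_sub_cancel]
    rw [this]
    exact sum_range_pow_succ_le hg0.le hg1 _
  have hcoef : 0 ≤ c₁ * c₂ ^ m * g ^ (m - 3) * (A * lam ^ (m - 1) * Q ^ m) := by positivity
  calc c₁ * c₂ ^ m * g ^ (m - 3) * (A * lam ^ (m - 1) * Q ^ m) * ∑ k' ∈ range (k + 1), g ^ (k - k' + 1)
      ≤ c₁ * c₂ ^ m * g ^ (m - 3) * (A * lam ^ (m - 1) * Q ^ m) * (g / (1 - g)) :=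
        mul_le_mul_of_nonneg_left hgeom hcoef
    _ = c₁ * A / ((1 - g) * g ^ 2) * lam ^ (m - 1) * (c₂ * g * Q) ^ m := by
        have hg3 : g ^ m = g ^ (m - 3) * g * g ^ 2 := by
          rw [← pow_succ, ← pow_add]; congr 1; omega
        rw [mul_pow, mul_pow, hg3]
        field_simp


/-- **(T1′) Read-out re-measurement (jump ≥ 0)**: at a boundary itself (or inside the following block) the newest increment is measured with
no gain, `μ ≤ Σ_{k'≤k} c₁ c₂^m g^{(m−2)(k−k')} b k' m` ⇒ `μ ≤ (c₁A/(1−g)) · λ^{m−1} · (c₂ Q)^m` — the profile the public read-out consumes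
(per-leg-pair constant `c₂Q`, absorbed in the public `CE`; nothing is fed back). -/
theorem towerMeasured_le_profile₀ {D : ℕ} {b μ : ℕ → ℕ → ℝ} {A lam Q g c₁ c₂ : ℝ}
    (hA : 0 ≤ A) (hlam : 0 ≤ lam) (hQ : 0 ≤ Q) (hg0 : 0 ≤ g) (hg1 : g < 1) (hc₁ : 0 ≤ c₁) (hc₂ : 0 ≤ c₂)
    (hb0 : ∀ k m, 0 ≤ b k m) {k : ℕ}
    (hμ : ∀ m, 3 ≤ m → m ≤ D → μ k m ≤ ∑ k' ∈ range (k + 1), c₁ * c₂ ^ m * g ^ ((m - 2) * (k - k')) * b k' m)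
    (hborn : ∀ k' ≤ k, ∀ m, 3 ≤ m → m ≤ D → b k' m ≤ A * lam ^ (m - 1) * Q ^ m)
    {m : ℕ} (hm : 3 ≤ m) (hmD : m ≤ D) :
    μ k m ≤ c₁ * A / (1 - g) * lam ^ (m - 1) * (c₂ * Q) ^ m := by
  have hg1' : 0 < 1 - g := sub_pos.2 hg1
  refine (hμ m hm hmD).trans ?_
  have hterm : ∀ k' ∈ range (k + 1), c₁ * c₂ ^ m * g ^ ((m - 2) * (k - k')) * b k' m ≤
      (c₁ * c₂ ^ m * (A * lam ^ (m - 1) * Q ^ m)) * g ^ (k - k') := by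
    intro k' hk'
    have hk'le : k' ≤ k := Nat.lt_succ_iff.1 (mem_range.1 hk')
    have hpow : g ^ ((m - 2) * (k - k')) ≤ g ^ (k - k') :=
      pow_le_pow_of_le_one hg0 hg1.le (by nlinarith [Nat.zero_le (k - k'), (by omega : 1 ≤ m - 2)])
    calc c₁ * c₂ ^ m * g ^ ((m - 2) * (k - k')) * b k' m
        ≤ c₁ * c₂ ^ m * g ^ (k - k') * (A * lam ^ (m - 1) * Q ^ m) := by
          have := hborn k' hk'le m hm hmD
          have := hb0 k' m
          gcongr
      _ = _ := by ring
  refine (sum_le_sum hterm).trans ?_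
  rw [← mul_sum]
  have hgeom : ∑ k' ∈ range (k + 1), g ^ (k - k') ≤ 1 / (1 - g) := by
    have hrefl := sum_range_reflect (fun t => g ^ t) (k + 1)
    have : ∑ k' ∈ range (k + 1), g ^ (k - k') = ∑ t ∈ range (k + 1), g ^ t := by
      rw [← hrefl]
      refine sum_congr rfl fun j hj => ?_
      simp only [Nat.add_sub_cancel]
    rw [this]
    have h := geom_sum_Ico_le_of_lt_one hg0 hg1 (m := 0) (n := k + 1)
    rwa [pow_zero, ← range_eq_Ico] at h
  have hcoef : 0 ≤ c₁ * c₂ ^ m * (A * lam ^ (m - 1) * Q ^ m) := by positivity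
  calc c₁ * c₂ ^ m * (A * lam ^ (m - 1) * Q ^ m) * ∑ k' ∈ range (k + 1), g ^ (k - k')
      ≤ c₁ * c₂ ^ m * (A * lam ^ (m - 1) * Q ^ m) * (1 / (1 - g)) := mul_le_mul_of_nonneg_left hgeom hcoef
    _ = c₁ * A / (1 - g) * lam ^ (m - 1) * (c₂ * Q) ^ m := by
        rw [mul_pow]
        field_simp

/-! ## §2 The block step for inputs with a geometric profile -/

/-- `Σ_{m ∈ (p, D]} x^{m−p} ≤ x/(1−x)` for `0 ≤ x < 1`. -/
theorem sum_Ioc_pow_sub_le {x : ℝ} (hx0 : 0 ≤ x) (hx1 : x < 1) (p D : ℕ) :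
    ∑ m ∈ Ioc p D, x ^ (m - p) ≤ x / (1 - x) := by
  have hI : Ioc p D = Ico (p + 1) (D + 1) := by ext m; simp only [mem_Ioc, mem_Ico]; omega
  rw [hI, sum_Ico_eq_sum_range]
  refine le_trans (le_of_eq (sum_congr rfl fun i _ => ?_)) (sum_range_pow_succ_le hx0 hx1 _)
  congr 1
  omega

/-- **The first order of a geometric profile**: if `0 ≤ μ m ≤ A' λ^{m−1} Q'^m` on `[1, D]`, then with `x₁ = 4σλQ' < 1`,
`FO(p) ≤ A' λ^{p−1} (4Q')^p · x₁/(1 − x₁)` for `1 ≤ p` (`C(2m,2p) ≤ 4^m`; the `m − p ≥ 1` contracted pairs give a geometric series in `x₁`). -/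
theorem towerFO_le {D : ℕ} {σ A' lam Q' : ℝ} {μ : ℕ → ℝ} (hσ : 0 ≤ σ) (hA' : 0 ≤ A') (hlam : 0 ≤ lam) (hQ' : 0 ≤ Q')
    (hμ0 : ∀ m, 0 ≤ μ m) (hprof : ∀ m, 1 ≤ m → m ≤ D → μ m ≤ A' * lam ^ (m - 1) * Q' ^ m)
    (hx₁ : 4 * σ * lam * Q' < 1) {p : ℕ} (hp : 1 ≤ p) :
    towerFO D σ μ p ≤ A' * lam ^ (p - 1) * (4 * Q') ^ p * (4 * σ * lam * Q' / (1 - 4 * σ * lam * Q')) := by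
  have hx0 : 0 ≤ 4 * σ * lam * Q' := by positivity
  have hterm : ∀ m ∈ Ioc p D, ((2 * m).choose (2 * p) : ℝ) * σ ^ (m - p) * μ m ≤
      A' * lam ^ (p - 1) * (4 * Q') ^ p * (4 * σ * lam * Q') ^ (m - p) := by
    intro m hm
    rw [mem_Ioc] at hm
    have hm1 : 1 ≤ m := by omega
    have hch : ((2 * m).choose (2 * p) : ℝ) ≤ (4 : ℝ) ^ m := by
      have h := Nat.choose_le_two_pow (2 * m) (2 * p)
      rw [pow_mul] at h
      exact_mod_cast h
    have hμm := hprof m hm1 hm.2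
    have hμ0m := hμ0 m
    calc ((2 * m).choose (2 * p) : ℝ) * σ ^ (m - p) * μ m
        ≤ (4 : ℝ) ^ m * σ ^ (m - p) * (A' * lam ^ (m - 1) * Q' ^ m) := by gcongr
      _ = A' * lam ^ (p - 1) * (4 * Q') ^ p * (4 * σ * lam * Q') ^ (m - p) := by
          have h1 : m = p + (m - p) := by omega
          have h2 : m - 1 = (p - 1) + (m - p) := by omega
          rw [h2, pow_add]
          conv_lhs => rw [h1, pow_add, Nat.add_sub_cancel_left, pow_add]
          rw [mul_pow, mul_pow, mul_pow, mul_pow]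
          ring
  refine (sum_le_sum hterm).trans ?_
  rw [← mul_sum]
  exact mul_le_mul_of_nonneg_left (sum_Ioc_pow_sub_le hx0 hx₁ p D) (by positivity)

/-- `Σ_{m ∈ [1, D]} x^{m−1} ≤ 1/(1−x)` for `0 ≤ x < 1`. -/
theorem sum_Icc_pow_sub_one_le {x : ℝ} (hx0 : 0 ≤ x) (hx1 : x < 1) (D : ℕ) :
    ∑ m ∈ Icc 1 D, x ^ (m - 1) ≤ 1 / (1 - x) := by
  have h := geom_sum_Ico_le_of_lt_one hx0 hx1 (m := 0) (n := D)
  rw [pow_zero, ← range_eq_Ico] at h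
  refine le_trans (le_of_eq ?_) h
  have hI : Icc 1 D = Ico 1 (D + 1) := by ext m; simp only [mem_Icc, mem_Ico]; omega
  rw [hI, sum_Ico_eq_sum_range, Nat.add_sub_cancel]
  exact sum_congr rfl fun i _ => by rw [Nat.add_sub_cancel_left]

/-- **The field-weighted norm of a geometric profile**: `V ≤ A'·eτQ'/(1 − eτλQ')` (`x₃ = eτλQ' < 1`). -/
theorem towerV_le {D : ℕ} {τ A' lam Q' : ℝ} {μ : ℕ → ℝ} (hτ : 0 ≤ τ) (hA' : 0 ≤ A') (hlam : 0 ≤ lam) (hQ' : 0 ≤ Q')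
    (hμ0 : ∀ m, 0 ≤ μ m) (hprof : ∀ m, 1 ≤ m → m ≤ D → μ m ≤ A' * lam ^ (m - 1) * Q' ^ m)
    (hx₃ : exp 1 * τ * lam * Q' < 1) :
    towerV D τ μ ≤ A' * (exp 1 * τ * Q') / (1 - exp 1 * τ * lam * Q') := by
  have hx0 : 0 ≤ exp 1 * τ * lam * Q' := by positivity
  have hterm : ∀ m ∈ Icc 1 D, (exp 1 * τ) ^ m * μ m ≤ A' * (exp 1 * τ * Q') * (exp 1 * τ * lam * Q') ^ (m - 1) := by
    intro m hm
    rw [mem_Icc] at hm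
    have hμm := hprof m hm.1 hm.2
    have hμ0m := hμ0 m
    calc (exp 1 * τ) ^ m * μ m ≤ (exp 1 * τ) ^ m * (A' * lam ^ (m - 1) * Q' ^ m) := by gcongr
      _ = A' * (exp 1 * τ * Q') * (exp 1 * τ * lam * Q') ^ (m - 1) := by
          obtain ⟨j, rfl⟩ : ∃ j, m = j + 1 := ⟨m - 1, by omega⟩
          simp only [Nat.add_sub_cancel, pow_succ, mul_pow]
          ring
  refine (sum_le_sum hterm).trans ?_
  rw [← mul_sum, div_eq_mul_one_div]
  exact mul_le_mul_of_nonneg_left (sum_Icc_pow_sub_one_le hx0 hx₃ D) (by positivity)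


/-- `Σ_{j ∈ [1, D]} (1/2)^j ≤ 1`. -/
theorem sum_Icc_half_pow_le_one (D : ℕ) : ∑ j ∈ Icc 1 D, (1 / 2 : ℝ) ^ j ≤ 1 := by
  have h := sum_Icc_pow_sub_one_le (x := (1 / 2 : ℝ)) (by norm_num) (by norm_num) D
  have heq : ∑ j ∈ Icc 1 D, (1 / 2 : ℝ) ^ j = (1 / 2) * ∑ j ∈ Icc 1 D, (1 / 2 : ℝ) ^ (j - 1) := by
    rw [mul_sum]
    refine sum_congr rfl fun j hj => ?_
    obtain ⟨i, rfl⟩ : ∃ i, j = i + 1 := ⟨j - 1, by have := (mem_Icc.1 hj).1; omega⟩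
    rw [Nat.add_sub_cancel, pow_succ, mul_comm]
  rw [heq]
  calc (1 / 2 : ℝ) * ∑ j ∈ Icc 1 D, (1 / 2 : ℝ) ^ (j - 1) ≤ (1 / 2) * (1 / (1 - 1 / 2)) :=
        mul_le_mul_of_nonneg_left h (by norm_num)
    _ = 1 := by norm_num

/-- **The graded product sum of a geometric profile keeps the perturbative order**: if `0 ≤ μ m ≤ A' λ^{m−1} Q'^m` on `[1, D]` and
`2λτQ' ≤ 1`, then for `1 ≤ n`, `1 ≤ p`, `S_n(p) ≤ A'^n · λ^{p−1} · (2τQ')^{p+n−1}` — the constraint `Σδ_a ≥ p+n−1` turns `Π λ^{δ_a−1}` into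
`λ^{p−1}·(λτQ')^{excess}`, the excess is traded for `2^{−Σδ_a}` (`2λτQ' ≤ 1`), and the free product sum `(Σ_j 2^{−j})^n ≤ 1` does the counting
(uniformly in `D`). -/
theorem towerS_le {D : ℕ} {τ A' lam Q' : ℝ} {μ : ℕ → ℝ} (hτ : 0 ≤ τ) (hA' : 0 ≤ A') (hlam : 0 ≤ lam) (hQ' : 0 ≤ Q')
    (hμ0 : ∀ m, 0 ≤ μ m) (hprof : ∀ m, 1 ≤ m → m ≤ D → μ m ≤ A' * lam ^ (m - 1) * Q' ^ m)
    (hx₂ : 2 * lam * τ * Q' ≤ 1) {n p : ℕ} (hn : 1 ≤ n) (hp : 1 ≤ p) :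
    towerS D τ μ n p ≤ A' ^ n * lam ^ (p - 1) * (2 * τ * Q') ^ (p + n - 1) := by
  set Cst : ℝ := A' ^ n * lam ^ (p - 1) * (2 * τ * Q') ^ (p + n - 1) with hCst
  have hCst0 : 0 ≤ Cst := by positivity
  have hx0 : 0 ≤ lam * τ * Q' := by positivity
  have hxh : lam * τ * Q' ≤ 1 / 2 := by linarith
  -- termwise
  have hterm : ∀ δ ∈ (Fintype.piFinset fun _ : Fin n => Icc 1 D).filter (fun δ => p + n - 1 ≤ ∑ a, δ a),
      ∏ a, τ ^ (δ a) * μ (δ a) ≤ Cst * ∏ a, (1 / 2 : ℝ) ^ (δ a) := by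
    intro δ hδ
    rw [mem_filter, Fintype.mem_piFinset] at hδ
    obtain ⟨hδD, hc⟩ := hδ
    have hδ1 : ∀ a, 1 ≤ δ a ∧ δ a ≤ D := fun a => mem_Icc.1 (hδD a)
    -- the profile, factor by factor
    have h1 : ∏ a, τ ^ (δ a) * μ (δ a) ≤ ∏ a, (A' * (lam ^ (δ a - 1) * (τ * Q') ^ (δ a))) := by
      refine prod_le_prod (fun a _ => by have := hμ0 (δ a); positivity) fun a _ => ?_
      calc τ ^ (δ a) * μ (δ a) ≤ τ ^ (δ a) * (A' * lam ^ (δ a - 1) * Q' ^ (δ a)) := by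
            have := hprof (δ a) (hδ1 a).1 (hδ1 a).2; have := hμ0 (δ a); gcongr
        _ = A' * (lam ^ (δ a - 1) * (τ * Q') ^ (δ a)) := by rw [mul_pow]; ring
    refine h1.trans ?_
    rw [prod_mul_distrib, prod_const, card_univ, Fintype.card_fin, prod_mul_distrib, prod_pow_eq_pow_sum, prod_pow_eq_pow_sum,
      prod_pow_eq_pow_sum]
    -- exponents
    set S := ∑ a, δ a with hS
    have hTS : ∑ a, (δ a - 1) + n = S := by
      have : ∑ a : Fin n, (δ a - 1) + ∑ _a : Fin n, 1 = ∑ a, δ a := by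
        rw [← sum_add_distrib]; exact sum_congr rfl fun a _ => Nat.sub_add_cancel (hδ1 a).1
      rw [sum_const, card_univ, Fintype.card_fin, smul_eq_mul, mul_one] at this
      exact this
    obtain ⟨r, hr⟩ : ∃ r, S = (p + n - 1) + r := ⟨S - (p + n - 1), by omega⟩
    have hT : ∑ a, (δ a - 1) = (p - 1) + r := by omega
    rw [hT, hr, pow_add, pow_add, pow_add, hCst]
    have hxr : (lam * τ * Q') ^ r ≤ (1 / 2 : ℝ) ^ r := pow_le_pow_left₀ hx0 hxh r
    have h2r : (2 * τ * Q') ^ (p + n - 1) * (1 / 2 : ℝ) ^ (p + n - 1) = (τ * Q') ^ (p + n - 1) := by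
      rw [← mul_pow]; congr 1; ring
    calc A' ^ n * (lam ^ (p - 1) * lam ^ r * ((τ * Q') ^ (p + n - 1) * (τ * Q') ^ r))
        = A' ^ n * lam ^ (p - 1) * (τ * Q') ^ (p + n - 1) * (lam * τ * Q') ^ r := by
          rw [mul_pow, mul_pow, mul_pow]; ring
      _ ≤ A' ^ n * lam ^ (p - 1) * (τ * Q') ^ (p + n - 1) * (1 / 2 : ℝ) ^ r :=
          mul_le_mul_of_nonneg_left hxr (by positivity)
      _ = A' ^ n * lam ^ (p - 1) * (2 * τ * Q') ^ (p + n - 1) * ((1 / 2 : ℝ) ^ (p + n - 1) * (1 / 2) ^ r) := by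
          rw [← h2r]; ring
  -- sum: drop the constraint, factor the free product sum
  unfold towerS
  refine (sum_le_sum hterm).trans ?_
  refine (sum_le_sum_of_subset_of_nonneg (filter_subset _ _) fun δ _ _ => by positivity).trans ?_
  rw [← mul_sum, ← prod_univ_sum]
  refine mul_le_of_le_one_right hCst0 ?_
  rw [prod_const, card_univ, Fintype.card_fin]
  exact pow_le_one₀ (sum_nonneg fun j _ => by positivity) (sum_Icc_half_pow_le_one D)

end Summit.HubbardSuperconductivity.HubbardSuperconductivity.Theorems.EngineV8

end
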